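import Mathlib
import HarnessLib
import HarnessLib.Audit
import Summits.BirchSwinnertonDyer.Statement
import Summits.BirchSwinnertonDyer.BirchSwinnertonDyer.Theorems.GoldfeldGoodTwistsAllTwistsLeaf
import Literature.NumberTheory.EllipticCurves.CaiShuTian2014.ExplicitGrossZagierRingClass
import Literature.NumberTheory.EllipticCurves.CoatesLiTianZhai2015.QuadraticTwistsX049
import Literature.NumberTheory.EllipticCurves.ManinConstantClassCertificate
import HarnessLib.Audit.Status.Attr

/-!
Route: GoldfeldAllTwistsTwoConverse

# Route GoldfeldAllTwistsTwoConverse — Goldfeld and BSD (rank and 2-part) for 100 % of ALL twists of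
X₀(49) via the rank-one 2-converse for ℚ(√−7)-CM curves at additive 2

It suffices to show two class-wide statements about the elliptic curves `E/ℚ` with CM by an order of
`K = ℚ(√−7)`
(`j(E) ∈ {−3375, 16581375}`; the one CM field in which `2` SPLITS), with NO reduction clause at `2`:
the RANK-ONE
`2`-CONVERSE K12₂′ `RankOneTwoConverseCMSevenAtAnyTwo` (`corank_{ℤ_2} Sel_{2^∞}(E/ℚ) = 1 ⟹ ord_{s=1}
L(E, s) = 1`)
and its FORMULA twin `BSDTwoCMSplitRankOne` (Miller's `BSD(E, 2)` for every such `E` of analytic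
rank `1`; verbatim the
tree target `P2.LTYZPotentiallyGoodOrdinaryAtTwo`). Together with the published named facts
`PublishedFactsAllTwists`
([Smi22a] Thm 1.2, Burungale–Tian, Gross–Zagier–Kolyvagin, the CM rank-`0` BSD triple, analytic
continuation) they
give the registered RUNG LEAF S1⁺ `GoldfeldAllTwistsX049` (D-0061): Goldfeld's conjecture for `E₀ =
X₀(49) = 49a1`
over ALL squarefree `d` (`1/2, 1/2, 0`) and, for `100 %` of all squarefree `d`, `ord_{s=1}
L(E₀^{(d)}, s) = rank`,
`Ш(E₀^{(d)}/ℚ)` finite and `BSD(W', 2)` for every minimal model `W'` of `E₀^{(d)}` — by the landed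
bridge
`goldfeldAllTwistsX049_of_inputs`. X = K12₂′ ∧ twin.
Lean: `(∀ (W : WeierstrassCurve ℚ) [W.IsElliptic], (W.j = -3375 ∨ W.j = 16581375) → W.selmerCorank 2
= 1 → W.analyticRank = 1) ∧ Summit.BirchSwinnertonDyer.Rank1Residual.P2.BSDTwoOn (fun W _ _ =>
W.HasCM ∧ Literature.NumberTheory.EllipticCurves.Rank1Residual.CMSplit W 2 ∧ W.analyticRank = 1)`

## Assembly
One application of the landed Theorems-side bridge `goldfeldAllTwistsX049_of_inputs` (file 12,
module
`GoldfeldGoodTwistsAllTwistsLeaf`): on Smith's density-`1` set `{corank_{ℤ_2} Sel_{2^∞}(E₀^{(d)}) ≤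
1}` — corank `0` ⟹
analytic rank `0` (Burungale–Tian) ⟹ full BSD at every prime for every minimal model
(Burungale–Flach, file 8
`rankZero_bsdTriple_of_selmerCorankTwoInfty_eq_zero`); corank `1` ⟹ analytic rank `1` (K12₂′) ⟹ rank
`1`, `Ш` finite
(GZK) and `BSD(W', 2)` (twin: `W'` has CM with `j = −3375`, so `2` splits,
`cmSplit_two_of_j_eq_neg3375`); the Goldfeld
clause is file 10's `goldfeld_allTwists_of_X049_of_twoConverse` (Smith's `1/2, 1/2, 0` for coranks
transported by the
two converses). Deciding theorem (glue.lean, rev 4): `closes (hK :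
RankOneTwoConverseCMSevenAtAnyTwo) (hL : BSDTwoCMSplitRankOne) (hF : PublishedFactsAllTwists) :
GoldfeldAllTwistsX049 := goldfeldAllTwistsX049_of_inputs hK hL hF.1 hF.2.1 hF.2.2.1 hF.2.2.2.1
hF.2.2.2.2` — the two cruxes are the load-bearing open content (BC1 cone = 2), the fact conjunction
`hF` is carried as a hypothesis, and the `Assembly` item (the same join, CLOSED:
`GoldfeldGoodTwists.assembly_goldfeldAllTwistsTwoConverse`) is NO LONGER a binder of `closes`
(tribunal kernel rule «a proved binder must not be load-bearing»; revs 2–3 read `closes (hAsm :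
Assembly) hK hL hF := hAsm hK hL hF`). Each crux is SPLIT at the reduction type of a minimal model
at `2` into its printed good cell (BCST Thm A, resp. LTYZ Thm 1.1 (ii), support items 20045 / 19141)
and its open ADDITIVE cell (items 20044 `RankOneTwoConverseCMSevenAdditiveTwo` / 19140
`BSDTwoCMSevenAdditiveRankOne`), glue items 20046 / 19142 CLOSED. PRINT PLACEMENT (2026-08-26):
K12₂′ is the `p = 2`, `𝒦 = ℚ(√−7)` slice of an UNREFEREED claim — Fan–Wan arXiv:2304.09806v2 Thm 1.1
(split case only sketched, §7 l.2394–2418, on [Venjakob]'s p = 2 explicit reciprocity law, itself a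
preprint) — typed as the hypothesis
`Literature.NumberTheory.EllipticCurves.FanWan2023.thmM_analyticRank_eq_one_of_selmerCorank_eq_one_CLAIMED`
and linked to this route's decls in `Theorems/GoldfeldCMTwistsOfFanWanClaim.lean` (claim ⟹ K12₂′ ⟹
leaf; credits nothing); expert print (BCST 2022 Rem. D, LTYZ 2025 §1.3, Smith 2025 Rem. 1.5) treats
the case as open.

CLOSES_TARGET: closes rung S1 of BirchSwinnertonDyer: Summit.BirchSwinnertonDyer.BirchSwinnertonDyer.Theorems.GoldfeldGoodTwists.GoldfeldAllTwistsX049 (D-0061; not the summit Statement) — the deciding theorem of this route concludes that registered leaf instead of the Statement decl `BirchSwinnertonDyer` (class rung: servable and labelled, never counted as concluding the summit Statement).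

Rationale: WHY THIS LINE. The cell's rung S1 (Goldfeld + rank BSD, and the `2`-part, for `100 %` of the GOOD
twists `𝓕 = {d ≡ 1 (mod 4)}` of
`49a1`) is a tree theorem modulo published binders (p397173, p401816, p403650, p403991): Smith's
`2^∞`-Selmer
distribution (arXiv250317619 Thm 1.1, for `49a1` from the refereed Smith2022SelmerTwistI Thm 1.2 via
`smithCaseII_cm7`)
puts `100 %` of twists in corank `≤ 1`; corank `0` is Burungale–Tian's rank-zero CM `2`-converse
(BurungaleTian2026, no
condition at `2`) plus Burungale–Flach; corank `1` on `𝓕` is Burungale–Castella–Skinner–Tian Thm A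
at `p = 2` (good
ORDINARY at `2`) plus Li–Tian–Yan–Zhu Thm 1.1 (ii). Over ALL `d` exactly one input is missing (file
10 §3,
`bsdRank_allTwists_of_X049_of_offClass_twoConverse`): the corank-`1` twists with `d ≢ 1 (mod 4)`,
where `E₀^{(d)}` has
ADDITIVE, potentially good ORDINARY reduction at `2` (`2` splits in `ℚ(√−7)`) — the case
BurungaleCastellaSkinnerTian2022
Rem. D and LiTianYanZhu2025 §1.3 (II) exclude and KellerYin2024PotOrd (Thm 0.1.2, `p > 2`, `E[p]`
reducible) proves for
ODD `p`; here `E₀^{(d)}[2](ℚ) = ℤ/2` (Eisenstein at `2`), the exact `p = 2` shape of Keller–Yin.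
Imported areas: Iwasawa
theory of CM fields at a split prime (Rubin / BDP anticyclotomic main conjecture, `2`-adic), Heegner
points and
Gross–Zagier (the converse's last step), probabilistic arithmetic statistics (Smith) only as a
published input. No open
BSD route touches the rank axis at `p = 2`; the p = 2 routes of bsd-cm (K7t, `X12.CMAtTwo`) are the
`ℚ(√−3)` Sylvester
curves (`2` INERT), a different mechanism (explicit Heegner index), and do not contain K12₂′. COMMON
COORDINATES (kernel,
2026-08-26): both open cells live on the NEGATIVE twists `d < 0`, `7 ∤ d`, `d ≢ 1 (mod 4)` (root
number `w(49a1^{(d)}) = sgn d` for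
`7 ∤ d`: p439576, p440148, p441964) and both are EQUIVALENT to statements about the ONE curve
`X₀(49)` over the imaginary quadratic
fields `K` with `4 ∣ d_K`: K12₂″ ⟺ `X049KLevelTwoConverseEvenDiscr` (p418192), twin″ ⟺
`X049BSDTwoOverKEvenDiscr` (p441096) — «rank-one
BSD at `2` for `X₀(49)` over even-discriminant imaginary quadratic fields». On the half of those `K`
where `7` splits (the level-`49`
Heegner fields) the ANALYTIC arrow of K12₂″ is refereed print: Kriz 2021 Thm 9.10 at `p = 2`
ramified (typed fact
`Kriz2021.thm910_exists_anticyclotomicLFunction`, p450565; consumer p451763: over the typed frame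
«𝓛(𝐍̌_K) ≠ 0» ⟺ the Heegner sub-leaf
`X049HeegnerNonTorsionEvenDiscr` of p443153); the ALGEBRAIC arrow (corank₂ `= 1 ⟹ 𝓛(𝐍̌_K) ≠ 0`), the
`7`-non-split half and the whole
formula axis are unprinted (print CLAIM only: Fan–Wan arXiv:2304.09806v2 §7 resting on
[Venjakob2025KupfererRegulator], unrefereed).

RANKED CRUXES. #2 RankOneTwoConverseCMSevenAtAnyTwo (crux) — K12₂′ — for every elliptic `W/ℚ` with
`j(W) ∈ {−3375, 16581375}` (CM by an order of `ℚ(√−7)`), ANY reduction at `2`: `corank_{ℤ_2}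
Sel_{2^∞}(W/ℚ) = 1 ⟹ ord_{s=1} L(W, s) = 1`. Model-free. The good-ordinary-at-`2` case is BCST Thm A
(tree fact `thmA_analyticRank_eq_one_of_selmerCorank_eq_one`); the new content is the additive
(potentially good ordinary) case, i.e. the twists `W = A^{(d)}`, `d ≢ 1 (mod 4)`, of the four `j =
−3375 / 16581375` curves of conductor `49`. [difficulty: XL] (why it might fail: the 2-adic
anticyclotomic main conjecture / BDP formula for ℚ(√−7) needs Rubin's IMC at p = 2 = #O_K^×
(excluded in Rubin 1991) and a 2-adic Gross–Zagier/BDP formula at ADDITIVE 2; either may fail or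
lose a power of 2 that kills "corank 1 ⇒ Heegner point non-torsion".)
[BurungaleCastellaSkinnerTian2022, KellerYin2024PotOrd, arXiv:2410.23241, BurungaleTian2026,
Rubin1991]
#3 BSDTwoCMSplitRankOne (crux) — the FORMULA twin (D-0056) — Miller's `BSD(E, 2)` (rank part,
`Ш[2^∞]` finite, `ord₂ #Ш_an = ord₂ #Ш[2^∞]`) for every globally minimal `E/ℚ` of analytic rank `≤
1` with CM, `2` split in the CM field (`K = ℚ(√−7)`) and analytic rank `1`, ANY reduction at `2`;
verbatim the body of the tree target
`Summit.BirchSwinnertonDyer.Rank1Residual.P2.LTYZPotentiallyGoodOrdinaryAtTwo` (Li–Tian–Yan–Zhu Thm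
1.1 (ii) with "good ordinary at 2" replaced by "2 split"). The good-ordinary sub-cell is LTYZ's
printed theorem; the additive sub-cell (`2 ∣ N`, the `d ≢ 1 (mod 4)` twists) is open. [difficulty:
XL] (why it might fail: at additive 2 the 2-part of #Ш_an involves the Tamagawa number c₂ and the
Manin/period normalisation of the twist; LTYZ's explicit Gross–Zagier comparison at p = 2 uses good
reduction at 2 (local computation at 2 ∤ N), and the additive local term may not match.)
[LiTianYanZhu2025, BurungaleCastellaSkinnerTian2022, Miller2011LMS, GrossZagier1986]
#9 PublishedFactsAllTwists (support) — the published named facts of the bridge as ONE conjunction,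
each a cite-tagged Literature `Prop` taken as a hypothesis (published, refereed theorems NOT
formalised in the tree: the item closes only by formalising the sources — a Literature-programme
task — and until then is carried as the hypothesis `hF` of `closes`, exactly as every BSD route
carries GZK / modularity): [Smi22a] Thm 1.2 (`smith2022_selmerCorank_distribution`, refereed; gives
Smith's law for `49a1` via the landed `smithCaseII_cm7`), Burungale–Tian Thm 1.1 (rank-`0` CM
`2^∞`-converse), Gross–Zagier–Kolyvagin (`r_an ≤ 1 ⇒ rank = r_an ∧ Ш finite`), the CM rank-`0` BSD
triple (Rubin / Burungale–Flach Cor. 2), analytic continuation of `L(E, s)` (modularity).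
[difficulty: XL] [Smith2022SelmerTwistI, BurungaleTian2026, GrossZagier1986, Kolyvagin1990,
BurungaleFlach2024, BreuilConradDiamondTaylor2001]

TWO-LAYER PLAN. RankOneTwoConverseCMSevenAtAnyTwo ⇐ (S2H: corank-`1` ⟹ for a Heegner field `L` of
`E` with `L(E^L, 1) ≠ 0` the Heegner
point `P_L ∈ E(L)` is non-torsion — the `2`-adic BDP/anticyclotomic argument for `ℚ(√−7)`-CM curves
at additive `2`,
the open content) → (H2R: a non-torsion Heegner point with `L(E^L,1) ≠ 0` ⟹ `ord_{s=1} L(E, s) = 1`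
— Gross–Zagier I.6.5
+ the factorisation `L(E/L, s) = L(E, s) L(E^L, s)`, essentially the tree's `gross_zagier` schema) →
K12₂′; plus the
isogeny reduction `j = 16581375 ⇝ j = −3375` (`2`-isogenous; Selmer corank and analytic rank are
isogeny invariants).
BSDTwoCMSplitRankOne ⇐ the tree's `L`-free Heegner-index equivalence
`P2.bsdp_two_iff_cmHeegnerIndex` (p396383):
lower half `ord₂ 𝔮 ≤ ord₂ #Ш` + upper half on the class `CMSplit W 2` (the pattern of bsd-cm's K7t
on 𝒞_HSY, here with
`2` SPLIT, where a `2`-adic Kolyvagin argument has the ordinary anticyclotomic tower available).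
REGISTERED skeletons (BC3, one per item): 20044 = v7.3 «sevens-halves» (planner g20, sha16
e86b829873aeefeb, supersedes v7 b4c87d6acda24e78 of g16; stubs `stub_heegnerHalfNonTorsion :
X049HeegnerNonTorsionEvenDiscr` (`7` split in the Heegner field), `stub_inertHalfGenusNonTorsion :
X049GenusPointNonTorsionInertSeven` (`7` inert: genus point `P_{χ_a}`),
`stub_printedInputsK12AtSeven` = FIVE named facts; composition + exactness `crux ↔ stub₂ ∧ stub₃`
p503649; v4 archived, v5/v6 NO), 19140 = «heegner-halves». RUNGS LANDED (BC5 witnesses, never items;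
all modulo NAMED printed facts only): Heegner half — LINE B49 THEOREM A (p502529
`x049GenusTheoremA_of_print` / `x049GenusPointOddMultiple_of_print`: for EVERY prime `q ≡ 1 (mod 4)`
with `(q/7) = −1` the level-`49` genus/Heegner point of `49a1^{(−q)}` is an odd multiple of `(0,i)`
up to torsion, hence non-torsion — clause (i) of `X049BirchLemmaEvenDiscr`, D(q) and K12₂″'s
conclusion on the whole inert-prime family); inert half — Kriz–Li 2019 Thm 1.20 at `p = 7` ON THE
TWIST over an auxiliary `ℚ(√−r)` (p495876 `rankOneTwoConverse_twist_cm7_even_of_thm120` = K12₂″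
OUTRIGHT on the double-`7`-unit locus, kernel certificates `n = 29, 53, 113`, census j267736:
`178/209` inert-half `n ≤ 1200`). Documented alternatives (checked rc 0, NOT registered — each has
its
research stub kernel-equivalent to a typed sub-leaf, i.e. no sharper partition): «kriz-ramified»
(HOME ROUTE-S1PLUS/lines-g10/; v2 with
the typed ALG stub) and «two-adic-links-cm7» (lines-c201g5/: K12₂′ ⟺ Link A-corank ∧ Link B modulo
the published inputs, 20045 and
Poitou–Tate, p451298/p455562 in bsd-cn100's `AcSelmer`/`AcPConverseLinks` currency; the research
content is Link A-corank = the CM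
two-variable / `ℤ₂^×`-tower control over `K₇` at `2`, for which the tree has no vocabulary yet).

KILL CRITERIA. A certified counterexample to K12₂′ — one twist `49a1^{(d)}`, `d ≢ 1 (mod 4)`, with
`2^∞`-Selmer corank `1` (2-descent +
Cassels–Tate to bound Ш[2^∞]) and `ord_{s=1} L = 3` proved (not numerically: NumericalVanishing) —
refutes
`RankOneTwoConverseCMSevenAtAnyTwo` and closes the route (`refuted:`); by parity (root number)
corank 1 forces odd analytic
rank, so the realistic kill is STRUCTURAL: a theorem that the 2-adic BDP/IMC input fails for ℚ(√−7)
at p = 2 (e.g. a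
µ ≠ 0 or a non-integrality at 2) forces a pivot to a Heegner-index / explicit Gross–Zagier line for
the twist family
(new items, same leaf). A refutation of the twin at ONE minimal model (certified `ord₂ #Ш` vs `ord₂
#Ш_an` for a rank-one
twist with additive 2, e.g. `49a1^{(-1)} = 784…`) closes `BSDTwoCMSplitRankOne` as typed and forces
its restriction to a
sub-class. Either crux proved in print moots the corresponding item (`superseded`).

NOT DECOMPOSED YET. K12₂″ stays ONE item on purpose; its decomposition lives at SKELETON level (v7
«sevens-halves»: the two Heegner-type non-torsion statements by the behaviour of `7` in the Heegner
field, each kernel-equivalent to the crux's restriction modulo print, neither alone the crux) and is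
NOT promoted to items: both halves are research statements with no printed proof at `2`, and a
route-level split would only rename them. ASIDE EDIT (xl), rev 10 (planner g20): the Theorem-A
discharge p502529 has as its ONLY binders the closed named facts Cai–Shu–Tian 2014 Thm 1.1,
Coates–Li–Tian–Zhai 2015 Thm 1.2 / Thm 4.4, bsd.S31 (Creutz–Miller), Modularity (+ the Manin
certificate of `49a1` for the genus-point input; Darmon 3.6 / Shimura reciprocity at conductor `1`
are PROVED in tree, `…_holds`) — item-stated BY NAME as six kind-aside rows
`CaiShuTianGrossZagierRingClass`, `CLTZRankZeroPrimeTwists`, `CLTZOrdTwoLAlgInertProduct`,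
`MillerBSDRankLeOneSmallConductor`, `NewformOfEllipticCurve` (shared), `OptimalManinCertificateX049`
(banked, never staffed). The
twin is likewise undivided (its Heegner-index halves exist class-wide in
`P2/CMRankOneAtTwoHeegnerIndexHalves`). The
isogeny reduction between the two `j`-invariants and every constant at `2` (Tamagawa `c₂` of the
additive twists, Manin
constant, the unit index `u`) are support lemmas on demand. FIRST INFINITE FAMILY beyond the Miller
rungs (the layer-2 meeting
point of both cells, kernel 2026-08-26): the inert prime twists `49a1^{(−q)}`, `q ≡ 1 (mod 4)`
prime, `(−7/q) = −1` — corank₂ `≤ 1`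
unconditionally and `= 1` modulo 2-parity (p443979, p444109, p445910); K12₂″ ⟹ Conjecture D(q):
`ord_{s=1} L(49a1^{(−q)}, s) = 1` for
every such `q` (`analyticRank_eq_one_inertPrimeTwist_of_crux`), and conversely the Heegner sub-leaf
at the single field `ℚ(√−q)` gives
D(q); on the twin side the residue on the 2-isogeny-descent families is the exact `2`-divisibility
of the level-`49` Heegner point =
LINE B49, typed as the even-discriminant Birch lemma `X049BirchLemmaEvenDiscr` (p462293: (i) the
level-`49` Heegner point
`y_K ∈ X₀(49)(ℚ(√−q))` has infinite order, (ii) `ord₂` of the Heegner quotient `𝔮₄₉` is `0`; the `d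
= −2q` variant `X049BirchLemmaEvenDiscrEight`
p466339) with sorry-free consumers: (i) ⟹ D(q) and K12₂″ on the family, (i) + (ii) ⟹ twin″ on the
family (`bsdp_two_inertPrimeTwist_of_birch`
p464700, with the descents' `Ш[2] = 0`; `twin″(W) ⟺ ord₂ 𝔮₄₉ = 0` p463308). KERNEL RUNGS
(2026-08-26/27): clause (i) — indeed `r_an = 1` outright,
with no corank hypothesis — is PROVED on the `7`-adic-UNIT locus by Kriz–Li 2019 Thm 1.20 at the
additive Eisenstein prime `p = 7` (typed fact
`KrizLi2019.thm120_padicLogHeegner_unit_of_bernoulli`):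
`not_isOfFinAddOrder_heegnerPoint_cm7_of_thm120`, `analyticRank_eq_one_inertPrimeTwist_of_thm120`,
`rankOneTwoConverse_inertPrimeTwist_of_thm120` (= K12₂″'s conclusion on the unit sub-family;
p471659, p472283), per-`q` `decide +kernel` Bernoulli-unit
certificates for `q = 5, 13, 17, 41, 61, 73, 89, 101` (p473413, p473414; bsd-cm RouteU E20/E52/E68),
and the even-discriminant generalisation to EVERY
imaginary quadratic `K` with `4 ∣ d_K` and `7` split (p473869: `r_an(49a1^{(−n)}) = 1` for every
squarefree `n ≡ 1, 2 (mod 4)` with `(−n/7) = +1` under the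
certificate for `n` — the unit locus of the whole Heegner half of the additive cell, a set of
POSITIVE twist density; instances `n = 6, 10`); on the
unit sub-family `twin″ ⟺ ord₂ 𝔮₄₉ = 0` with no `r_an` hypothesis
(`bsdp_two_iff_x049Quotient_unit_inertPrimeTwist_of_thm120`). KERNEL (2026-08-27, modulo the six
named facts above): B49 clause (i) for ALL `q` of the prime family `d_K = −4q` via the GENUS
CHARACTER `χ` of `ℚ(√−q)` — Theorem A chain W-A1 p490719, W-A2 p492765 + p495591 + p496128 ((RO) ⟸
CLTZ Thm 1.2 + c301's descent package on `W₇₈₄` p485778–p495335: rank `1`, `Ш[2] = 0`, `Tam = 8`,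
`leadingLCoeff_W784`), W-A3 p490968, W-A4 p496756 + p497940 (periods), W-A6 p500052 + p501957 ((HR):
`ĥ(P_χ) = r·ĥ((0,i))`, `v₂(r) = 0`, from Cai–Shu–Tian Thm 1.1 at `c = 1`, Gross 2004 discharged
`_holds`, unit index `u = 1`), discharge p502529; clause (ii) (`ord₂ 𝔮₄₉ = 0` ⟹ twin″ on every
minimal model) = THEOREM B, hand c301, in progress (memo GENUS-THEOREM-B.md); the `d = −2q` family
(F2) follows the same chain (partner `W₃₁₃₆`: p500303 / p500880 / p500967). LADDER CEILING of this
road (BC9): genus characters / Birch lemma / bounded `2`-divisibility reach exactly the `#Ш(W)` odd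
locus (complete on the prime families — `1011/1011` odd `Ш_an` — but `151/3021` Heegner-half and all
`(2,2)` census rows at composite `n` lie outside), and the Kriz–Li `p = 7` rung is capped at the
`7`-unit locus; the lift to density one is engine E1 (a `2`-adic two-variable main conjecture +
`2`-adic Rubin/BDP formula for `ψ_{49a1}·χ_d`, hypothesis wall at `2` in print) — the E1-regime
witness to aim for is an EVEN-`Ш` member (first target `n = 470`, `Ш_an = 4`). The prime families
have twist density ZERO — tree theorem `twistDensity_zero_inertPrimeTwists` — and the leaf
needs the two cells only off them (`goldfeldAllTwistsX049_of_cells_offPrimeTwists`, p470948): B49 is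
the cells' joint WITNESS rung, never a closer; density one
still needs engine E1 (CM two-variable Iwasawa theory at `2` over `K₇`: LTYZ (7.1) and Prop 7.5
typed as facts `LiTianYanZhu2025.eq71_charIdeal_divTower_eq_twoVariableLFunction`
p464124 / `prop75_charIdeal_selmerDual_cyclotomic_eq_katzLines` p473125; twist-line control +
explicit reciprocity at `2` = research) or E2 (Kolyvagin systems at `2`). WEAKEST SUFFICIENT FORM
(banked; the items stay POINTWISE): the
leaf is a density statement, so the cells need only hold off a twist-density-zero set —
`goldfeldAllTwistsX049_of_cells_offDensityZero`
(p449662) and the auxiliary-prime corollaries `…_withPrimeFactor / _withLargePrimeFactor /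
_withPrimeFactorInDense` (p452826–p455645;
Legendre / Dirichlet-density sieve p452101, p454017): a line may ASSUME prime factors of `d` of any
prescribed Frobenius type, and the
items are re-typed to such a restriction (census-falsifiable, never an `∃ Z`) only when a line
actually uses the freedom.

CHEAPEST FALSIFIER. RUN (kit, PARI 2.15.4 `ellanalyticrank` + `ellrank` 2-descent): every quadratic
twist `49a1^{(d)}` ADDITIVE at `2`,
squarefree `|d| ≤ 30000` — j246894 (planner g6, `|d| ≤ 3000`: 2434 twists, `r_an` histogram
`[0,1,2,3] = [1038, 1190, 185, 21]`),
j250010 (planner g8, `3001 ≤ |d| ≤ 12000`: 7291 twists, `[3146, 3585, 505, 55]`), j250939 (hand c201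
g2, `12001 ≤ |d| ≤ 30000`,
odd-parity half checked directly: 14598 twists, 7298 with `w = +1`, 7214 with `r_an = 1` of which
7189 with CERTIFIED corank `1`
(`rhi = 1`), 86 with `r_an = 3`). By `2`-parity (Dokchitser–Dokchitser) + GZK a numerical
counterexample to K12₂″ needs `w = −1`,
`r_an ≥ 3` and a `2`-descent/Cassels–Tate bound `rhi = 1`; RESULT over all 24 323 additive twists:
`0` anomalies (`r_an > rhi`), `0` kill
candidates — every `r_an ≥ 2` twist with `|d| ≤ 12000` (766) but ONE has rank `= r_an` exhibited
(`rlo = rhi = r_an`, hence corank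
`= r_an ≥ 2`), the exception `d = 11579` (`r_an = 2`, `rlo = 0`, `rhi = 2`) has EVEN parity and is
not an instance; all 86 `r_an = 3`
twists with `12001 ≤ |d| ≤ 30000` are cleared (`rlo = 3`). Tables: HOME
`ROUTE-S1PLUS/split-g6/falsifier_j246894.txt`,
`lines-g8/falsifier_j250010.txt`, `k12pp-c201g2/rows_all_j250939_d12001-30000.txt` (evidence on
items 19349 / 20044). Twin side
(hands c301 / c3, kit j248486 + j248731 + j253202, `|d| ≤ 3000`): numerical `BSD(E,2)` for ALL 1190
`r_an = 1` additive twists —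
census COMPLETE, `(ord₂ #Ш_an, dim Ш[2]) ∈ {(0,0) × 1157, (2,2) × 33}`, `0` violation candidates
(the 67 generator-less curves resolved by
level-`49` Heegner points on `X₀(49)`, tool HOME `ROUTE-S1PLUS/twin-c3g3/nogen49.py`); extension
j253611 (c3 g3, `3000 < |d| ≤ 20000`):
6127 of 6785 rank-`1` additive twists resolved, `0` violation candidates, 658 without generator (`7`
inert in `ℚ(√d)` or `d > 0`), 16
predicted `Ш[2^∞] ≅ (ℤ/4)²`; two empirical laws with `0` exceptions on 16 216 additive twists:
`w(49a1^{(d)}) = sgn(d)·(−1)^{[7 ∣ d]}` (a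
kernel theorem for `7 ∤ d`) and explicit Gross–Zagier `L′(W,1) = Ω_W·ĥ_W(y_K − ȳ_K)` on the `(d/7) =
+1`, `d < 0` half (3021 curves; memo
HOME/TWIN-CENSUS-G3.md, tables `twin-c3g3/`); plus kernel instances: rank `= 1 =` corank₂, `Ш[2^∞] =
0` for every model of `49a1^{(−13)}`, `49a1^{(−26)}`
(p434730) and c301's unconditional `2`-isogeny descents (rank `≤ 1`, `Ш[2] = 0` at rank `1`) on the
inert/split prime-twist
sub-families (15 files, p426978–p434570). The numerical line is therefore exhausted as a CHEAP kill
below `|d| = 30000`; the realistic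
kill stays STRUCTURAL (KILL CRITERIA), and the next numeric step, if wanted, is the `w = −1` half to
`|d| ≤ 10⁵` (≈ 40 core-h, one
kit job, c201's `twist49_k12pp.gp`). RUNG-LEVEL falsifiers (they would kill a rung's typed reading,
not the route): a `7`-unit `n` with a TORSION
level-`49` Heegner point over `ℚ(√−n)` would refute the typed reading of Kriz–Li Thm 1.20 (none: the
eight certified primes and `n = 6, 10` have
`r_an = 1 = rank` in PARI as well); a prime `q` of the families `−q, −2q` with `λ` even, or with
`y_K ∈ 2E₀(K) + tors`, would refute B49 (none among `1204`
(family, `q`) pairs, `q < 20000`, kit j260494 / j260701; the half-trace identity `z + z̄ = T` holds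
to `10⁻³⁶` at `q = 5, 13, 61, 101, 173, 229`, kit j259794).

NUMBERS. Density bookkeeping (tree theorems): `𝓕 = {d ≡ 1 (mod 4)}` has density `1/3` of squarefree
`d`
(`twistDensity_emod_four_eq_one`), so S1 covers `1/3 + 1/2·(2/3)` … precisely: rank BSD holds for
density `≥ 2/3` of all
twists unconditionally-modulo-print (`bsdRank_twoThirds_allTwists_of_X049`: corank `0` half +
corank-`1`∩𝓕 sixth), and
the residual set has density exactly `1/3` (`twistDensity_not_rankZero_or_rankOneInClass_X049`) =
corank-`1` twists with
`d ≢ 1 (mod 4)`. Smith: coranks `0 / 1 / ≥ 2` have densities `1/2 / 1/2 / 0` (arXiv250317619 Thm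
1.1; for `49a1` from
Smith2022SelmerTwistI Thm 1.2, Assumption 1.1 case (2) certified in tree). BCST Thm A: `p` split in
`K`, good ordinary;
Keller–Yin Thm 0.1.2: `p > 2`. KL19 unit census (HOME `ROUTE-S1PLUS/lines-g12/`): `482` of the `572`
primes `q < 20000`, `q ≡ 1 (mod 4)`,
`(q/7) = −1` are `7`-units (`84 %`); kernel certificate residues `S(q) mod 49 = 28, 42, 7, 21, 21`
for `q = 41, 61, 73, 89, 101`. Genus census: `λ ∈ {1, 3, …, 21}`,
`λ² ≤ 441`, `ρ₁ = 2.000000000` (CST's constant) in `181/181`.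

DEFINITION REQUESTS. None: `selmerCorank`, `analyticRank`, `BSDTwoOn`, `CMSplit`, `BSDp`,
`twistDensity`, `cm7` are tree definitions; the
leaf `GoldfeldAllTwistsX049` and the crux decl are file 12 (`GoldfeldGoodTwistsAllTwistsLeaf`, this
seat).

Novelty: Searches (2026-08-25): lit search --hybrid "p-converse theorem CM elliptic curve at p = 2
potentially good ordinary additive reduction Selmer corank one implies analytic rank one" -n 8 (8
docs, all textbooks: silverman1994 pp 409/261, silverman2009 p 298, delbourgo2008 p 24, cornell1997
p 130, coates1999 p 95 — no converse theorem at additive 2); lit vsearch "<the crux in prose>" -k 8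
(8 textbook hits, none relevant); lit search "p-converse CM potentially ordinary" (corpus 2 docs:
paper:doi-10-1007-s40316-022-00203-y p 3 = BCST 2022 Rem. D naming the potentially-good-ordinary
case as the desideratum; paper:arxiv-2410.23241 pp 2–4 = Keller–Yin, p ≥ 3; remote: openalex/s2 HTTP
429, arxiv/zbmath 1 hit = Keller–Yin); lit galaxy search "p-converse|2-converse|potentially good
ordinary" --star all -n 10 (9 rows, all junk: Arabian Nights etc.); lean search / grep of the tree
(K12₂′ exists only as file 10's inline hypothesis `hK`; the twin is
`P2.LTYZPotentiallyGoodOrdinaryAtTwo`, open); ledger negatives --problem BirchSwinnertonDyer (1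
entry, LeadingTermTamePinch, unrelated).
Nearest prior art found (page-read locators: HOME/K12-2PRIME-LIT-BRIEF.md §3, bsd-goldfeld-lit g12,
2026-08-25T20:31Z): [corpus:paper:doi-10-1007-s40316-022-00203-y p.3]
BurungaleCastellaSkinnerTian2022 Thm A p. 326 (rank-one p-converse for CM curves, p split in K, GOOD
ORDINARY) and Rem. D p. 327 verbatim «E should be allowed to have just potentially good ordinary
reduction at p (this might be approachable by o  [refs: 2210.10730, 2008.02571, 2002.04767, paper:doi-10-1007-s40316-022-00203-y, paper:arxiv-2410.23241, BurungaleCastellaSkinnerTian2022, CastellaGrossiLeeSkinner2022, LiTianYanZhu2025, Kriz2020, BurungaleTian2026]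

Barriers (technique_class: p-converse, heegner-points, iwasawa-main-conjecture): - technique_class: p-converse, heegner-points, iwasawa-main-conjecture
- Literature.Barriers.BirchSwinnertonDyer.HeegnerPointBarrier: inside its regime by design — both
cruxes live in analytic rank ≤ 1 (corank₂ = 1 ⟹ a non-torsion Heegner/CM point ⟹ r_an = 1); the
barrier quantifies over `2 ≤ W.analyticRank`, a range the route never enters (Smith's corank ≥ 2 set
has density 0 and is discarded, not decided).
- Literature.Barriers.BirchSwinnertonDyer.HeegnerPointBarrierNarrow: same placement — the bottom
Heegner/CM class is used as a point supply only in analytic rank 1 over an auxiliary K′ with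
r_an(E/K′) = 1 (BCST/Keller–Yin shape), exactly the entry's non-obstructed case; nothing is claimed
in rank ≥ 2.
- Literature.Barriers.BirchSwinnertonDyer.SelmerRankBarrier: EVADED BY DESIGN (the entry's own
`evasions_known`: p-converse theorems turning corank Sel_{p^∞} = 1 into a non-torsion Heegner point
without assuming Ш finite [WZhang2014, Thm. 1.3; Skinner2020]) — no step reads rank E(ℚ) off a
Selmer group: corank₂ = 1 ⟹ ANALYTIC rank 1 (crux K12₂′), then rank and Ш-finiteness come from
Gross–Zagier–Kolyvagin (tree fact `rank_eq_analyticRank_of_analyticRank_le_one`).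
- Literature.Barriers.BirchSwinnertonDyer.SelmerRankBarrierNarrow: outside — neither crux is a
Selmer-side-only conclusion: K12₂′ concludes `W.analyticRank = 1` and the twin concludes `BSDp W 2`
(a leading-term statement), the corank being a HYPOTHESIS, not the output.
- Literature.Barriers.BirchSwinnertonDyer.Except

sub-problem: BirchSwinnertonDyer · status: open · opened planner-bsd-goldfeld-plan-g5-0 2026-08-25T21:34:25Z · rev 10 · ledger route-BirchSwinnertonDyer-GoldfeldAllTwistsTwoConverse
GENERATED by the gate from the ledger (D-0016/17). Provers cite these decls: `theorem foo : Summit.BirchSwinnertonDyer.BirchSwinnertonDyer.Theses.GoldfeldAllTwistsTwoConverse.<Decl> := …` in Summits/BirchSwinnertonDyer/BirchSwinnertonDyer/Theorems/<Name>.lean.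
-/

namespace Summit.BirchSwinnertonDyer.BirchSwinnertonDyer.Theses.GoldfeldAllTwistsTwoConverse

open scoped BigOperators Topology Manifold Classical MeasureTheory ProbabilityTheory Matrix InnerProductSpace ComplexConjugate ContinuousMap
open Filter Set Function TopologicalSpace MeasureTheory

attribute [summit_statement] _root_.BirchSwinnertonDyer
attribute [summit_statement] _root_.Summit.BirchSwinnertonDyer.BirchSwinnertonDyer.Theorems.GoldfeldGoodTwists.GoldfeldAllTwistsX049

open Literature

/-- item stmt-BirchSwinnertonDyer-19349 · crux · rank 2 · SPLIT (gen 1) into RankOneTwoConverseCMSevenAdditiveTwo, BCSTThmARankOneConverse + glue RankOneTwoConverseCMSevenAtAnyTwoOfCells · direct attempts still welcome (low priority) · by planner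
why it might fail: the 2-adic anticyclotomic main conjecture / BDP formula for ℚ(√−7) needs Rubin's IMC at p = 2 = #O_K^× (excluded in Rubin 1991) and a 2-adic Gross–Zagier/BDP formula at ADDITIVE 2; either may fail or lose a power of 2 that kills "corank 1 ⇒ Heegner point non-torsion".
sources: BurungaleCastellaSkinnerTian2022, KellerYin2024PotOrd, arXiv:2410.23241, BurungaleTian2026, Rubin1991
[crux] K12₂′ — for every elliptic `W/ℚ` with `j(W) ∈ {−3375, 16581375}` (CM by an order of
`ℚ(√−7)`), ANY reduction at `2`: `corank_{ℤ_2} Sel_{2^∞}(W/ℚ) = 1 ⟹ ord_{s=1} L(W, s) = 1`.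
Model-free. The good-ordinary-at-`2` case is BCST Thm A (tree fact
`thmA_analyticRank_eq_one_of_selmerCorank_eq_one`); the new content is the additive (potentially
good ordinary) case, i.e. the twists `W = A^{(d)}`, `d ≢ 1 (mod 4)`, of the four `j = −3375 /
16581375` curves of conductor `49`. [difficulty: XL] -/
@[route_item "route-BirchSwinnertonDyer-GoldfeldAllTwistsTwoConverse", crux]
def RankOneTwoConverseCMSevenAtAnyTwo : Prop :=
  ∀ (W : WeierstrassCurve ℚ) [W.IsElliptic], (W.j = -3375 ∨ W.j = 16581375) → W.selmerCorank 2 = 1 → W.analyticRank = 1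

-- parent: RankOneTwoConverseCMSevenAtAnyTwo · child (gen 1)
/--     item stmt-BirchSwinnertonDyer-20044 · crux · rank 201 · open
    parent: RankOneTwoConverseCMSevenAtAnyTwo · by operator
    why it might fail: At p = 2 with additive (potentially ordinary) reduction the BDP/anticyclotomic main conjecture and 2-adic Kolyvagin inputs behind every printed p-converse are missing (BCST Rem. D, LTYZ §1.3 (II)); #O_K^× = 2 and c_2, w_2 of 49a1^(D), D ≢ 1 (4), obstruct Heegner non-vanishing mod 2.
    sources: BurungaleCastellaSkinnerTian2022, LiTianYanZhu2025, KellerYin2024PotOrd, arXiv:2410.23241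
[crux K12₂″ — the ADDITIVE cell of K12₂′] For every globally minimal elliptic W/ℚ with j(W) = −3375
(CM by the maximal order of ℚ(√−7), the one CM field in which 2 splits) that does NOT have good
reduction at 2 (then additive; these are the quadratic twists 49a1^(D), D ≢ 1 (mod 4), up to
isogeny): corank_{ℤ₂} Sel_{2^∞}(W/ℚ) = 1 ⟹ ord_{s=1} L(W,s) = 1. Verbatim the body of tree decl
Theorems.GoldfeldGoodTwists.RankOneTwoConverseCMSevenAdditiveTwo (file 13) and of the registered
stub stub_twoConverse_additive. Parent K12₂′ ⟺ this cell granted BCST Thm A (tree theorem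
rankOneTwoConverseCMSevenAtAnyTwo_iff_additiveCell). The p > 2 analogue (potentially good ordinary
p-converse) is Keller–Yin arXiv:2410.23241 Thm 0.1.2; BCST Rem. D and LTYZ §1.3 (II) name this p = 2
additive case as excluded. First rung (tree, file 13):
rankOneTwoConverseCMSevenAdditiveTwo_of_conductorNorm_lt (N < 5000, r_an ≤ 1, from Miller 2011 /
Creutz–Miller 2012 named facts). -/
@[route_item "route-BirchSwinnertonDyer-GoldfeldAllTwistsTwoConverse", crux]
def RankOneTwoConverseCMSevenAdditiveTwo : Prop :=
  ∀ (W : WeierstrassCurve ℚ) [W.IsElliptic] [W.IsGloballyMinimal], W.j = -3375 → ¬ W.HasGoodReductionAtPrime 2 → W.selmerCorank 2 = 1 → W.analyticRank = 1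

-- parent: RankOneTwoConverseCMSevenAtAnyTwo · child (gen 1)
/--     item stmt-BirchSwinnertonDyer-20045 · support · rank 202 · open
    parent: RankOneTwoConverseCMSevenAtAnyTwo · by operator
[support, PRINTED — closes only by formalising the source; carried as a hypothesis exactly like
PublishedFactsAllTwists] Burungale–Castella–Skinner–Tian, Ann. Math. Qué. 46 (2022) Thm. A: for a CM
elliptic curve E/ℚ and a prime p of good ORDINARY reduction (p = 2 allowed: Rem. D, K = ℚ(√−7)),
corank_{ℤ_p} Sel_{p^∞}(E/ℚ) = 1 ⟹ ord_{s=1} L(E,s) = 1 — the tree's cite-tagged Literature Prop, by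
name. It is the GOOD cell of the parent K12₂′ (tree theorem rankOneTwoConverse_goodCell_of_thmA,
file 13). -/
@[route_item "route-BirchSwinnertonDyer-GoldfeldAllTwistsTwoConverse", crux]
def BCSTThmARankOneConverse : Prop :=
  Literature.NumberTheory.EllipticCurves.BurungaleCastellaSkinnerTian2022.thmA_analyticRank_eq_one_of_selmerCorank_eq_one

-- parent: RankOneTwoConverseCMSevenAtAnyTwo · glue (gen 1)
/--     item stmt-BirchSwinnertonDyer-20046 · support · rank 203 · closed · proved by Summit.BirchSwinnertonDyer.BirchSwinnertonDyer.Theorems.GoldfeldGoodTwists.rankOneTwoConverseCMSevenAtAnyTwo_of_cells (planner)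
    parent: RankOneTwoConverseCMSevenAtAnyTwo · GLUE: children ⟹ parent · by operator
K12₂′ ⟸ its ADDITIVE cell K12₂″ (child RankOneTwoConverseCMSevenAdditiveTwo) + BCST 2022 Thm A
(child BCSTThmARankOneConverse = the printed good-ordinary cell as the tree's cite-tagged fact
constant): reduce to a globally minimal isogenous model with j = −3375 (corank Sel_{2^∞}, r_an and
the reduction type at 2 are isogeny invariants — tree theorems), then split on good / not good at 2
(Deuring at 2: good ⟹ ordinary for d_K = −7). PROVED in tree file 13
Theorems/GoldfeldGoodTwistsAllTwistsCells.lean (p410378, commit eac0f0ad8e10):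
`rankOneTwoConverseCMSevenAtAnyTwo_of_additiveCell hA hXL`; this glue item closes by `fun hXL hA =>
rankOneTwoConverseCMSevenAtAnyTwo_of_additiveCell hA hXL` (certificate split-g6/Sketch_split.lean rc
0). -/
@[route_item "route-BirchSwinnertonDyer-GoldfeldAllTwistsTwoConverse"]
def RankOneTwoConverseCMSevenAtAnyTwoOfCells : Prop :=
  RankOneTwoConverseCMSevenAdditiveTwo → BCSTThmARankOneConverse → RankOneTwoConverseCMSevenAtAnyTwo

-- `RankOneTwoConverseCMSevenAtAnyTwoOfCells` holds: proved by `Summit.BirchSwinnertonDyer.BirchSwinnertonDyer.Theorems.GoldfeldGoodTwists.rankOneTwoConverseCMSevenAtAnyTwo_of_cells` (its module imports this route file, so no `_holds` link can be stated here).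

/-- item stmt-BirchSwinnertonDyer-19350 · crux · rank 3 · SPLIT (gen 1) into BSDTwoCMSevenAdditiveRankOne, LTYZThm11CMRankOnePPart + glue BSDTwoCMSplitRankOneOfCells · direct attempts still welcome (low priority) · by planner
why it might fail: at additive 2 the 2-part of #Ш_an involves the Tamagawa number c₂ and the Manin/period normalisation of the twist; LTYZ's explicit Gross–Zagier comparison at p = 2 uses good reduction at 2 (local computation at 2 ∤ N), and the additive local term may not match.
sources: LiTianYanZhu2025, BurungaleCastellaSkinnerTian2022, Miller2011LMS, GrossZagier1986
[crux] the FORMULA twin (D-0056) — Miller's `BSD(E, 2)` (rank part, `Ш[2^∞]` finite, `ord₂ #Ш_an =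
ord₂ #Ш[2^∞]`) for every globally minimal `E/ℚ` of analytic rank `≤ 1` with CM, `2` split in the CM
field (`K = ℚ(√−7)`) and analytic rank `1`, ANY reduction at `2`; verbatim the body of the tree
target `Summit.BirchSwinnertonDyer.Rank1Residual.P2.LTYZPotentiallyGoodOrdinaryAtTwo`
(Li–Tian–Yan–Zhu Thm 1.1 (ii) with "good ordinary at 2" replaced by "2 split"). The good-ordinary
sub-cell is LTYZ's printed theorem; the additive sub-cell (`2 ∣ N`, the `d ≢ 1 (mod 4)` twists) is
open. [difficulty: XL] -/
@[route_item "route-BirchSwinnertonDyer-GoldfeldAllTwistsTwoConverse", crux]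
def BSDTwoCMSplitRankOne : Prop :=
  Summit.BirchSwinnertonDyer.Rank1Residual.P2.BSDTwoOn fun W _ _ => W.HasCM ∧ Literature.NumberTheory.EllipticCurves.Rank1Residual.CMSplit W 2 ∧ W.analyticRank = 1

-- parent: BSDTwoCMSplitRankOne · child (gen 1)
/--     item stmt-BirchSwinnertonDyer-19140 · crux · rank 301 · open
    parent: BSDTwoCMSplitRankOne · by operator
    why it might fail: The 2-part of BSD for additive-at-2 CM curves needs an explicit 2-adic Waldspurger/Gross–Zagier formula and a 2-adic anticyclotomic main conjecture over ℚ(√−7) with 2 | N — none in print (LTYZ §1.3 (II)); c_2 ∈ {1,2,4} and #O_K^× = 2 may break the unit pattern used at odd p.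
    sources: LiTianYanZhu2025, BurungaleCastellaSkinnerTian2022, Miller2011LMS, doi:10.4310/pamq.251115004959
[crux twin″ — the ADDITIVE cell of the BSD(E,2) twin, FORMULA axis at 2 (D-0056)] Miller's BSD(W,2)
(rank part, finiteness of Ш(2), ord₂ #Ш_an = ord₂ #Ш(2)) for every globally minimal CM W/ℚ with 2
SPLIT in the CM field (K = ℚ(√−7), j ∈ {−3375, 16581375}) that does NOT have good reduction at 2, of
analytic rank 1. Verbatim the body of tree decl
Theorems.GoldfeldGoodTwists.BSDTwoCMSevenAdditiveRankOne (file 13) and of the registered stub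
stub_bsdTwo_cmSplit_additive. Parent (≡ P2.LTYZPotentiallyGoodOrdinaryAtTwo) ⟺ this cell granted
LTYZ Thm 1.1 (ii) (tree theorem ltyzPotentiallyGoodOrdinaryAtTwo_iff_additiveCell). In print only
for N < 5000 (Miller 2011 Thm 1.2: classes 784h, 3136r; tree rung
bsdTwoCMSevenAdditiveRankOne_of_conductorNorm_lt, file 13); the four open P2 cells
r1.addv.<img>.split. -/
@[route_item "route-BirchSwinnertonDyer-GoldfeldAllTwistsTwoConverse"]
def BSDTwoCMSevenAdditiveRankOne : Prop :=
  ∀ (W : WeierstrassCurve ℚ) [W.IsElliptic] [W.IsGloballyMinimal], W.HasCM → Literature.NumberTheory.EllipticCurves.Rank1Residual.CMSplit W 2 → ¬ W.HasGoodReductionAtPrime 2 → W.analyticRank = 1 → Literature.NumberTheory.EllipticCurves.BSDp W 2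

-- parent: BSDTwoCMSplitRankOne · child (gen 1)
/--     item stmt-BirchSwinnertonDyer-19141 · support · rank 302 · open
    parent: BSDTwoCMSplitRankOne · by operator
[support, PRINTED — closes only by formalising the source; carried as a hypothesis exactly like
PublishedFactsAllTwists] Li–Tian–Yan–Zhu 2025 (PAMQ 21, doi:10.4310/pamq.251115004959) Thm. 1.1: the
p-part of the BSD formula for CM elliptic curves E/ℚ of analytic rank 1 at every prime p (p split in
K if p ≠ 2; good ordinary at p if p = 2) — the tree's cite-tagged Literature Prop, by name. It is
the GOOD cell of the parent twin (tree theorem bsdTwo_cmSplit_goodCell_of_thm11, file 13). -/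
@[route_item "route-BirchSwinnertonDyer-GoldfeldAllTwistsTwoConverse", crux]
def LTYZThm11CMRankOnePPart : Prop :=
  Literature.NumberTheory.EllipticCurves.LiTianYanZhu2025.thm11_bsdp_of_cm_rank_one

-- parent: BSDTwoCMSplitRankOne · glue (gen 1)
/--     item stmt-BirchSwinnertonDyer-19142 · support · rank 303 · closed · proved by Summit.BirchSwinnertonDyer.BirchSwinnertonDyer.Theorems.GoldfeldGoodTwists.bsdTwoCMSplitRankOne_of_cells (planner)
    parent: BSDTwoCMSplitRankOne · GLUE: children ⟹ parent · by operator
twin (BSDTwoCMSplitRankOne ≡ P2.LTYZPotentiallyGoodOrdinaryAtTwo) ⟸ its ADDITIVE cell twin″ (child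
BSDTwoCMSevenAdditiveRankOne) + Li–Tian–Yan–Zhu 2025 Thm 1.1 (child LTYZThm11CMRankOnePPart = the
printed good-ordinary cell as the tree's cite-tagged fact constant): split on good / not good at 2
on the given minimal model (Deuring at 2: CMSplit W 2 ∧ good ⟹ ordinary, tree
X12.goodOrd_two_iff_cmSplit_two). PROVED in tree file 13 (p410378):
`ltyzPotentiallyGoodOrdinaryAtTwo_of_additiveCell hLTYZ hXL`; this glue item closes by `fun hXL h11
=> ltyzPotentiallyGoodOrdinaryAtTwo_of_additiveCell h11 hXL` (certificate split-g6/Sketch_split.lean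
rc 0). -/
@[route_item "route-BirchSwinnertonDyer-GoldfeldAllTwistsTwoConverse"]
def BSDTwoCMSplitRankOneOfCells : Prop :=
  BSDTwoCMSevenAdditiveRankOne → LTYZThm11CMRankOnePPart → BSDTwoCMSplitRankOne

-- `BSDTwoCMSplitRankOneOfCells` holds: proved by `Summit.BirchSwinnertonDyer.BirchSwinnertonDyer.Theorems.GoldfeldGoodTwists.bsdTwoCMSplitRankOne_of_cells` (its module imports this route file, so no `_holds` link can be stated here).

/-- item stmt-BirchSwinnertonDyer-19273 · aside · rank 9 · open · by planner
sources: BreuilConradDiamondTaylor2001, Literature.NumberTheory.EllipticCurves.AnalyticRank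
[support] entire continuation of L(E/ℚ, s) (modularity: Breuil–Conrad–Diamond–Taylor 2001 Thm A +
Hecke/Shimura), BY NAME — conjunct of MultConversePublishedInputsAtTwo (19185); same content, filed
so the head constant is item-stated (#15c one rule; cite_only dep) -/
@[route_item "route-BirchSwinnertonDyer-GoldfeldAllTwistsTwoConverse"]
def EntireLFunctionRat : Prop :=
  WeierstrassCurve.hasEntireLFunction_rat

/-- item stmt-BirchSwinnertonDyer-19351 · support · rank 9 · open · by planner
sources: Smith2022SelmerTwistI, BurungaleTian2026, GrossZagier1986, Kolyvagin1990, BurungaleFlach2024, BreuilConradDiamondTaylor2001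
[support] the published named facts of the bridge as ONE conjunction, each a cite-tagged Literature
`Prop` taken as a hypothesis (published, refereed theorems NOT formalised in the tree: the item
closes only by formalising the sources — a Literature-programme task — and until then is carried as
the hypothesis `hF` of `closes`, exactly as every BSD route carries GZK / modularity): [Smi22a] Thm
1.2 (`smith2022_selmerCorank_distribution`, refereed; gives Smith's law for `49a1` via the landed
`smithCaseII_cm7`), Burungale–Tian Thm 1.1 (rank-`0` CM `2^∞`-converse), Gross–Zagier–Kolyvagin
(`r_an ≤ 1 ⇒ rank = r_an ∧ Ш finite`), the CM rank-`0` BSD triple (Rubin / Burungale–Flach Cor. 2),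
analytic continuation of `L(E, s)` (modularity). [difficulty: XL] -/
@[route_item "route-BirchSwinnertonDyer-GoldfeldAllTwistsTwoConverse", crux]
def PublishedFactsAllTwists : Prop :=
  Literature.NumberTheory.EllipticCurves.smith2022_selmerCorank_distribution ∧ Literature.NumberTheory.EllipticCurves.burungaleTian_analyticRank_eq_zero_of_selmerCorank_eq_zero_of_hasCM ∧ Literature.NumberTheory.EllipticCurves.rank_eq_analyticRank_of_analyticRank_le_one ∧ Literature.NumberTheory.EllipticCurves.bsdTriple_of_hasCM_of_L_one_ne_zero ∧ WeierstrassCurve.hasEntireLFunction_rat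

/-- item stmt-BirchSwinnertonDyer-19382 · aside · rank 9 · open · by planner
sources: BCDTJAMS2001, Thm. A, Wiles1995, Literature.NumberTheory.EllipticCurves.CuspFormLFunction
[support] Modularity Theorem, Version L (Diamond–Shurman 2005 Thm. 8.8.3; Wiles / Taylor–Wiles /
BCDT 2001 Thm. A): every E/ℚ has a weight-2 newform f of level N_E with L(f,s) = L(E,s) — conjunct
of PublishedInputsFive (stmt-BirchSwinnertonDyer-19066), BY NAME; same content, filed as a split
child so the head constant is item-stated (gate5 #15c one rule / readiness rule 2026-08-15: a
cite_only dep must be declared by the route); no crux statement / closes / tribunal / tribunal_fit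
change -/
@[route_item "route-BirchSwinnertonDyer-GoldfeldAllTwistsTwoConverse"]
def NewformOfEllipticCurve : Prop :=
  Literature.NumberTheory.EllipticCurves.ModularForms.exists_isNewformOf

/-- item stmt-BirchSwinnertonDyer-19423 · aside · rank 9 · open · by planner
sources: BurungaleFlach2024, Literature.NumberTheory.EllipticCurves.ComplexMultiplication
[support, cite-level BY-NAME ALIAS of a published input — never a prover target; held]
Burungale–Flach 2024 Thm. 1.1 + Cor. 2 (with Rubin 1991 Thm. 12.3 at p ∤ #O_K^×): the full BSD
formula for CM elliptic curves over ℚ with L(E,1) ≠ 0 at EVERY prime p. Conjunct 2 of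
`PublishedInputsFineSelmerCM` (stmt 19387; closes the CM rows of the U₀-ns child); filed under this
split ONLY to item-state the constant (unused by the glue). -/
@[route_item "route-BirchSwinnertonDyer-GoldfeldAllTwistsTwoConverse"]
def CMRankZeroBSDTriple : Prop :=
  Literature.NumberTheory.EllipticCurves.bsdTriple_of_hasCM_of_L_one_ne_zero

/-- item stmt-BirchSwinnertonDyer-19553 · aside · rank 9 · open · by operator
sources: Smith2022SelmerTwistI, Literature.NumberTheory.EllipticCurves.BSDSelmerSmithDecomposition
[aside · published input BY NAME] Smith 2022 (Selmer groups and twists I) Thm 1.2: the 2^∞-Selmer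
corank distribution over quadratic twist families — the named Literature fact
`smith2022_selmerCorank_distribution`, first conjunct of PublishedFactsAllTwists (19351);
item-stated so the cite_only leaf is declared; banked context, never staffed. -/
@[route_item "route-BirchSwinnertonDyer-GoldfeldAllTwistsTwoConverse"]
def SmithSelmerCorankDistribution : Prop :=
  Literature.NumberTheory.EllipticCurves.smith2022_selmerCorank_distribution

/-- item stmt-BirchSwinnertonDyer-19554 · aside · rank 9 · open · by operator
sources: BurungaleTian2026, Literature.NumberTheory.EllipticCurves.BSDSelmerCMPConverse
[aside · published input BY NAME] Burungale–Tian Thm 1.1: for CM E/ℚ, 2^∞-Selmer corank 0 ⇒ analytic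
rank 0 — the named Literature fact
`burungaleTian_analyticRank_eq_zero_of_selmerCorank_eq_zero_of_hasCM`, second conjunct of
PublishedFactsAllTwists (19351); item-stated so the cite_only leaf is declared; banked context,
never staffed. -/
@[route_item "route-BirchSwinnertonDyer-GoldfeldAllTwistsTwoConverse"]
def BurungaleTianRankZeroCMConverse : Prop :=
  Literature.NumberTheory.EllipticCurves.burungaleTian_analyticRank_eq_zero_of_selmerCorank_eq_zero_of_hasCM

/-- item stmt-BirchSwinnertonDyer-19921 · aside · rank 9 · open · by operator
sources: GrossZagier1986, Kolyvagin1990, Literature.NumberTheory.EllipticCurves.LeadingTerm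
[support] The one PUBLISHED input the halves-glue consumes: Gross–Zagier–Kolyvagin, rank = analytic
rank for analytic rank ≤ 1 with Ш finite (tree named fact
rank_eq_analyticRank_of_analyticRank_le_one; used by bsdp_of_missingPPartAt to turn Miller's last
clause into BSD(E,2)). Carried as a displayed PUB hypothesis; never counted as progress. The further
PRINT of the roads to the two halves (Greenberg Thm-4.1 analogues at a multiplicative prime
thm41Analogue_charValue_rankZero_numberField_anyPrime / …_split_baseChange_anyPrime, modularity) and
the referee-passed MEMO inputs (Kato ⊗ℚ at a multiplicative 2:
X5.O1.KatoMultiplicativeDivisibilityRat W 2, HOME mult/PROOF-MULT.md RC-2; Greenberg–Stevens at 2: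
greenberg_stevens W 2, mult/PROOF-GS2.md RC-4) enter the LINES under the halves (bridge
multiplicativeRankZeroAtTwo_of_muRoad, p409679), not this glue. -/
@[route_item "route-BirchSwinnertonDyer-GoldfeldAllTwistsTwoConverse"]
def RankEqAnalyticRankLeOne : Prop :=
  Literature.NumberTheory.EllipticCurves.rank_eq_analyticRank_of_analyticRank_le_one

/-- item stmt-BirchSwinnertonDyer-20081 · aside · rank 9 · open · by planner
sources: CaiShuTian2014, Thm. 1.1 (pp. 2524–2525), Literature.NumberTheory.EllipticCurves.CaiShuTian2014.ExplicitGrossZagierRingClass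
[aside · published input BY NAME] Cai–Shu–Tian 2014 (ANT 8) Thm 1.1: the explicit Gross–Zagier
formula for ring class characters (used at c = 1 for the genus character χ of ℚ(√−q)); binder `hCST`
— printed input consumed BY NAME by the landed sorry-free Theorem-A discharge
`x049GenusTheoremA_of_print` / `x049GenusPointOddMultiple_of_print` (c3 g8, p502529, commit
34484c36a743) of LINE B49 (Heegner half of K12₂″ 20044 skeleton v7 «sevens-halves» / twin″ 19140
«heegner-halves»: clause (i) of `X049BirchLemmaEvenDiscr`, D(q) ∀ inert-prime q); item-stated so the
cite_only leaf is declared (rev-6 precedent «every published leaf an item»); banked context, never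
staffed, not progress. -/
@[route_item "route-BirchSwinnertonDyer-GoldfeldAllTwistsTwoConverse"]
def CaiShuTianGrossZagierRingClass : Prop :=
  Literature.NumberTheory.EllipticCurves.CaiShuTian2014.thm11_ringClassChar

/-- item stmt-BirchSwinnertonDyer-20082 · aside · rank 9 · open · by planner
sources: CoatesLiTianZhai2015, Thm. 1.2 (p. 359), Literature.NumberTheory.EllipticCurves.CoatesLiTianZhai2015.QuadraticTwistsX049
[aside · published input BY NAME] Coates–Li–Tian–Zhai 2015 (PLMS 110) Thm 1.2: L(A^{(M)},1) ≠ 0, #Ш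
odd and full BSD for the rank-0 twists A^{(M)} of A = X₀(49) by products of inert primes ≡ 1 (mod
4); binder `h12` — printed input consumed BY NAME by the landed sorry-free Theorem-A discharge
`x049GenusTheoremA_of_print` / `x049GenusPointOddMultiple_of_print` (c3 g8, p502529, commit
34484c36a743) of LINE B49 (Heegner half of K12₂″ 20044 skeleton v7 «sevens-halves» / twin″ 19140
«heegner-halves»: clause (i) of `X049BirchLemmaEvenDiscr`, D(q) ∀ inert-prime q); item-stated so the
cite_only leaf is declared (rev-6 precedent «every published leaf an item»); banked context, never
staffed, not progress. -/
@[route_item "route-BirchSwinnertonDyer-GoldfeldAllTwistsTwoConverse"]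
def CLTZRankZeroPrimeTwists : Prop :=
  Literature.NumberTheory.EllipticCurves.CoatesLiTianZhai2015.thm12_fullBSD_twist

/-- item stmt-BirchSwinnertonDyer-20083 · aside · rank 9 · open · by planner
sources: CoatesLiTianZhai2015, Thm. 4.4, Literature.NumberTheory.EllipticCurves.CoatesLiTianZhai2015.QuadraticTwistsX049
[aside · published input BY NAME] Coates–Li–Tian–Zhai 2015 Thm 4.4 (with Zhao): ord₂
L^{alg}(A^{(M)}, 1) = k − 1 for M a product of k inert primes ≡ 1 (mod 4) (typed p490968); binder
`h44` of the height-ratio step (HR) — printed input consumed BY NAME by the landed sorry-free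
Theorem-A discharge `x049GenusTheoremA_of_print` / `x049GenusPointOddMultiple_of_print` (c3 g8,
p502529, commit 34484c36a743) of LINE B49 (Heegner half of K12₂″ 20044 skeleton v7 «sevens-halves» /
twin″ 19140 «heegner-halves»: clause (i) of `X049BirchLemmaEvenDiscr`, D(q) ∀ inert-prime q);
item-stated so the cite_only leaf is declared (rev-6 precedent «every published leaf an item»);
banked context, never staffed, not progress. -/
@[route_item "route-BirchSwinnertonDyer-GoldfeldAllTwistsTwoConverse"]
def CLTZOrdTwoLAlgInertProduct : Prop :=
  Literature.NumberTheory.EllipticCurves.CoatesLiTianZhai2015.thm44_ord_two_LAlg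

/-- item stmt-BirchSwinnertonDyer-20084 · aside · rank 9 · open · by planner
sources: CreutzMiller2012, Thm 1.1, Miller2011LMS, Thm 1.2, LawsonWuthrich2016, §5, Literature.NumberTheory.EllipticCurves.BSDRootNumber
[aside · published input BY NAME] bsd.S31 — Creutz–Miller 2012 Thm 1.1 (+ Miller 2011 Thm 1.2,
Lawson–Wuthrich 2016 §5): the full BSD triple for every E/ℚ of Mordell–Weil rank ≤ 1 and conductor <
5000 (used ONLY for the fixed partner curve of conductor 784, BSD₂(784) inside `leadingLCoeff_W784`;
Tam(W₇₈₄) = 8 and the odd index are kernel theorems of c301); binder `hS31` — printed input consumed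
BY NAME by the landed sorry-free Theorem-A discharge `x049GenusTheoremA_of_print` /
`x049GenusPointOddMultiple_of_print` (c3 g8, p502529, commit 34484c36a743) of LINE B49 (Heegner half
of K12₂″ 20044 skeleton v7 «sevens-halves» / twin″ 19140 «heegner-halves»: clause (i) of
`X049BirchLemmaEvenDiscr`, D(q) ∀ inert-prime q); item-stated so the cite_only leaf is declared
(rev-6 precedent «every published leaf an item»); banked context, never staffed, not progress. -/
@[route_item "route-BirchSwinnertonDyer-GoldfeldAllTwistsTwoConverse"]
def MillerBSDRankLeOneSmallConductor : Prop :=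
  Literature.NumberTheory.EllipticCurves.bsdTriple_of_rank_le_one_of_conductor_lt

/-- item stmt-BirchSwinnertonDyer-20085 · aside · rank 9 · open · by planner
sources: AgasheRibetStein2006, Thm. 2.6 and App. §5, Cremona2022ManinConstants, Literature.NumberTheory.EllipticCurves.ManinConstantClassCertificate
[aside · published input BY NAME] Agashe–Ribet–Stein 2006 Thm 2.6 + App. §5 / Cremona's tables: cm7
= [1,−1,0,−2,−1] is a model of the OPTIMAL curve 49a1 and the class has Manin constant 1
(`OptimalCurveManinCertificate cm7`); binder `hM` of the genus-point input
`x049GenusPointOddMultiple_of_print` only (Theorem A itself does not use it; its other two inputs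
Darmon 2004 Thm 3.6 `phi_heegnerTau_mem_singularModuliField 49 cm7 K` and Shimura reciprocity
`heegnerPointOfConductor_one_galoisConj 49 cm7 K` are PROVED in tree — `…_holds`, planner g20 check
rc 0 — hence no rows) — printed input consumed BY NAME by the landed sorry-free Theorem-A discharge
`x049GenusTheoremA_of_print` / `x049GenusPointOddMultiple_of_print` (c3 g8, p502529, commit
34484c36a743) of LINE B49 (Heegner half of K12₂″ 20044 skeleton v7 «sevens-halves» / twin″ 19140
«heegner-halves»: clause (i) of `X049BirchLemmaEvenDiscr`, D(q) ∀ inert-prime q); item-stated so the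
cite_only leaf is declared (rev-6 precedent «every published leaf an item»); banked context, never
staffed, not progress. -/
@[route_item "route-BirchSwinnertonDyer-GoldfeldAllTwistsTwoConverse"]
def OptimalManinCertificateX049 : Prop :=
  Literature.NumberTheory.EllipticCurves.ModularForms.OptimalCurveManinCertificate Literature.NumberTheory.EllipticCurves.cm7

/-- item stmt-BirchSwinnertonDyer-19352 · assembly · rank 1 · closed · proved by Summit.BirchSwinnertonDyer.BirchSwinnertonDyer.Theorems.GoldfeldGoodTwists.assembly_goldfeldAllTwistsTwoConverse @ e3ac6f88013e (planner) · by planner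
sources: arXiv250317619, BurungaleTian2026, BurungaleCastellaSkinnerTian2022, LiTianYanZhu2025
[assembly] the join — RankOneTwoConverseCMSevenAtAnyTwo → BSDTwoCMSplitRankOne →
PublishedFactsAllTwists → GoldfeldAllTwistsX049 (the rung leaf S1⁺). PROVABLE NOW in one line from
the landed bridge (`fun hK hL hF => goldfeldAllTwistsX049_of_inputs hK hL hF.1 hF.2.1 hF.2.2.1
hF.2.2.2.1 hF.2.2.2.2`, file 12); it is a binder of `closes` (join pattern of bsd-eis K5 / bsd-ssimc
K3, so that every declared item is load-bearing — BC6) and the first item a prover should close.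
[difficulty: provable-now] -/
@[route_item "route-BirchSwinnertonDyer-GoldfeldAllTwistsTwoConverse"]
def Assembly : Prop :=
  RankOneTwoConverseCMSevenAtAnyTwo → BSDTwoCMSplitRankOne → PublishedFactsAllTwists → Summit.BirchSwinnertonDyer.BirchSwinnertonDyer.Theorems.GoldfeldGoodTwists.GoldfeldAllTwistsX049

-- `Assembly` holds: proved by `Summit.BirchSwinnertonDyer.BirchSwinnertonDyer.Theorems.GoldfeldGoodTwists.assembly_goldfeldAllTwistsTwoConverse` @ e3ac6f88013e (its module imports this route file, so no `_holds` link can be stated here).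

/-! D-0027 §2.1 — DECIDING THEOREM (planner-authored via `route open/edit --closes-file`; by planner-bsd-goldfeld-plan-g7-0 2026-08-26T02:04:08Z):
its hypotheses are this route's items and its conclusion the registered leaf `Summit.BirchSwinnertonDyer.BirchSwinnertonDyer.Theorems.GoldfeldGoodTwists.GoldfeldAllTwistsX049` (rung S1, D-0061) (glue_lint), and it elaborates with this file. -/

/-- Deciding theorem (D-0027 §2.1; R5 alternative closer, D-0061: concludes the registered rung leaf
S1⁺ `GoldfeldGoodTwists.GoldfeldAllTwistsX049` — Goldfeld `1/2, 1/2, 0` over ALL squarefree twists of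
`X₀(49)` and, for `100 %` of them, `ord_{s=1} L = rank`, `Ш` finite and `BSD(W', 2)` for every minimal
model). Rev-4 shape (tribunal kernel feedback 2026-08-26 «a proved binder must not be load-bearing»):
the `Assembly` item is CLOSED (proved by `GoldfeldGoodTwists.assembly_goldfeldAllTwistsTwoConverse`,
file 14), so `closes` consumes only the two open cruxes — K12₂′ `RankOneTwoConverseCMSevenAtAnyTwo` and
its formula twin `BSDTwoCMSplitRankOne` (verbatim `P2.LTYZPotentiallyGoodOrdinaryAtTwo`), each SPLIT at
rev 2 into {additive cell at 2 (new mathematics), printed good-cell input (by-name fact), proved glue} —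
and the five published facts `PublishedFactsAllTwists`, through the Theorems-side bridge
`goldfeldAllTwistsX049_of_inputs` (file 12, `GoldfeldGoodTwistsAllTwistsLeaf`). -/
@[closes "route-BirchSwinnertonDyer-GoldfeldAllTwistsTwoConverse"] theorem closes (hK : RankOneTwoConverseCMSevenAtAnyTwo) (hL : BSDTwoCMSplitRankOne)
    (hF : PublishedFactsAllTwists) :
    Summit.BirchSwinnertonDyer.BirchSwinnertonDyer.Theorems.GoldfeldGoodTwists.GoldfeldAllTwistsX049 :=
  Summit.BirchSwinnertonDyer.BirchSwinnertonDyer.Theorems.GoldfeldGoodTwists.goldfeldAllTwistsX049_of_inputs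
    hK hL hF.1 hF.2.1 hF.2.2.1 hF.2.2.2.1 hF.2.2.2.2

end Summit.BirchSwinnertonDyer.BirchSwinnertonDyer.Theses.GoldfeldAllTwistsTwoConverse
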